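import Summits.HubbardSuperconductivity.HubbardSuperconductivity.Theorems.AnisotropyChordInsertionEntropyLatticeSum
import Summits.HubbardSuperconductivity.HubbardSuperconductivity.Theorems.AnisotropyChordInsertionEntropyFourier

/-!
# Route `AnisotropyChord` / H0 rotor rung: THEOREM TWIST-IR stub (S4) — the NEAR-FIELD LEMMA for even
# trigonometric polynomials on `(ℤ/L)²` (memo ROTOR-THEORY-8 §107 L4 / §109 (S4)), PROVED

Theory seat `hubbard-h0-rotor-theory-1`, cycle 8, skeleton spec S-TWIST (memo §109): «(S4) NEAR FIELD = a lemma
about trigonometric polynomials on (ℤ/L)²: if `P(k) = Σ_{|r|_∞ ≤ R} c(r) e^{ik·r}`, `c(−r) = c(r)` and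
`|P(k′)| ≤ B` at every grid momentum `k′`, then `|P(k) − P(0)| ≤ |k|² R² (2R+1) B` for every grid `k`
[`Σ_r |c(r)| ≤ (2R+1)(Σ|c|²)^{1/2} ≤ (2R+1)B` by Parseval + sup; `|cos k·r − 1| ≤ (k·r)²/2 ≤ |k|²R²`].»

In the tree's currency: `P = kernelFT L c` (`AnisotropyChordInsertionEntropyInfrared`), `|k| = torusNorm L k`,
`|r|_∞ = maxᵢ |valMinAbs rᵢ|`, Parseval = `sum_kernelFT_mul_conj` (p596356).

* `torusPhase_eq_cexp_valMinAbs`, `torusPhase_re_eq_cos` — the phase through SIGNED representatives,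
  `φ_k(r) = exp(i θ)`, `θ = (2π/L) Σᵢ valMinAbs(kᵢ) valMinAbs(rᵢ)`;
* `kernelFT_eq_sum_mul_cos` — for even `c`, `P(k) = Σ_r c(r) cos θ(k,r)` (real);
* `sq_signedPhase_le` — `θ(k,r)² ≤ 2 |k|_T² R²` on `|r|_∞ ≤ R` (Cauchy–Schwarz; with `1 − cos θ ≤ θ²/2`);
* `sum_abs_le_of_support` — `Σ_r |c(r)| ≤ (2R+1) (Σ_r c(r)²)^{1/2}`; `sum_sq_le_of_kernelFT_le` — `Σ_r c(r)² ≤ B²`;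
* **`norm_kernelFT_sub_kernelFT_zero_le`** — the near-field bound `|P(k) − P(0)| ≤ |k|_T² R² (2R+1) B`.
-/

set_option linter.dupNamespace false

noncomputable section

open Matrix Complex Finset Filter Topology
open scoped ComplexConjugate Real
open Literature.MathematicalPhysics.QuantumLattice Literature.Probability.LatticeModels
open Summit.HubbardSuperconductivity.HubbardSuperconductivity.Theorems.AnisotropyChord.InsertionEntropy

namespace Summit.HubbardSuperconductivity.HubbardSuperconductivity.Theorems.AnisotropyChord.Stiffness

variable {L : ℕ} [NeZero L]

/-! ## The phase through signed representatives -/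

/-- `φ_k(r) = exp(i (2π/L) Σᵢ valMinAbs(kᵢ) valMinAbs(rᵢ))`. [folklore] -/
theorem torusPhase_eq_cexp_valMinAbs (k r : TorusSite 2 L) :
    torusPhase L k r = cexp (((2 * π / (L : ℝ) *
        ∑ i, (((k i).valMinAbs : ℤ) : ℝ) * (((r i).valMinAbs : ℤ) : ℝ) : ℝ) : ℂ) * I) := by
  rw [torusPhase_eq_torusChar]
  unfold torusChar
  have h : ∀ i, (ZMod.stdAddChar (k i * r i) : ℂ)
      = cexp (2 * π * I * (((k i).valMinAbs * (r i).valMinAbs : ℤ) : ℂ) / (L : ℂ)) := by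
    intro i
    have e : k i * r i = (((k i).valMinAbs * (r i).valMinAbs : ℤ) : ZMod L) := by
      rw [Int.cast_mul, ZMod.coe_valMinAbs, ZMod.coe_valMinAbs]
    rw [e, ZMod.stdAddChar_coe]
  simp_rw [h]
  rw [← Complex.exp_sum]
  congr 1
  push_cast
  rw [Finset.mul_sum, Finset.sum_mul]
  refine Finset.sum_congr rfl fun i _ => ?_
  ring

/-- `Re φ_k(r) = cos θ(k,r)`. [folklore] -/
theorem torusPhase_re_eq_cos (k r : TorusSite 2 L) :
    (torusPhase L k r).re
      = Real.cos (2 * π / (L : ℝ) * ∑ i, (((k i).valMinAbs : ℤ) : ℝ) * (((r i).valMinAbs : ℤ) : ℝ)) := by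
  rw [torusPhase_eq_cexp_valMinAbs, Complex.exp_ofReal_mul_I_re]

/-- **Even kernels have cosine transforms:** `c(−r) = c(r)` ⇒ `P(k) = Σ_r c(r) cos θ(k,r)` (real). [folklore] -/
theorem kernelFT_eq_sum_mul_cos (c : TorusSite 2 L → ℝ) (heven : ∀ r, c (-r) = c r) (k : TorusSite 2 L) :
    kernelFT L c k = ((∑ r, c r *
        Real.cos (2 * π / (L : ℝ) * ∑ i, (((k i).valMinAbs : ℤ) : ℝ) * (((r i).valMinAbs : ℤ) : ℝ)) : ℝ) : ℂ) := by
  unfold kernelFT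
  -- the transform equals its reflected form `Σ_r c(r) conj φ_k(r)`
  have hrefl : ∑ r, (c r : ℂ) * torusPhase L k r = ∑ r, (c r : ℂ) * conj (torusPhase L k r) := by
    rw [← Equiv.sum_comp (Equiv.neg (TorusSite 2 L)) (fun r => (c r : ℂ) * torusPhase L k r)]
    refine Finset.sum_congr rfl fun r _ => ?_
    simp only [Equiv.neg_apply]
    rw [heven r, torusPhase_neg_right]
  -- average the two forms
  have h2 : (2 : ℂ) * ∑ r, (c r : ℂ) * torusPhase L k r
      = ∑ r, (c r : ℂ) * (torusPhase L k r + conj (torusPhase L k r)) := by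
    rw [two_mul]
    nth_rw 2 [hrefl]
    rw [← Finset.sum_add_distrib]
    refine Finset.sum_congr rfl fun r _ => by ring
  have h3 : ∀ r, torusPhase L k r + conj (torusPhase L k r) = ((2 * (torusPhase L k r).re : ℝ) : ℂ) := by
    intro r
    rw [Complex.add_conj]
  simp_rw [h3, torusPhase_re_eq_cos] at h2
  have h4 : ∑ r, (c r : ℂ) * ((2 * Real.cos (2 * π / (L : ℝ) *
      ∑ i, (((k i).valMinAbs : ℤ) : ℝ) * (((r i).valMinAbs : ℤ) : ℝ)) : ℝ) : ℂ)
      = (2 : ℂ) * ((∑ r, c r * Real.cos (2 * π / (L : ℝ) *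
          ∑ i, (((k i).valMinAbs : ℤ) : ℝ) * (((r i).valMinAbs : ℤ) : ℝ)) : ℝ) : ℂ) := by
    push_cast
    rw [Finset.mul_sum]
    refine Finset.sum_congr rfl fun r _ => by ring
  rw [h4] at h2
  exact mul_left_cancel₀ (two_ne_zero) h2

/-! ## The three estimates -/

/-- **The signed phase is second-order small:** on `|r|_∞ ≤ R`, `θ(k,r)² ≤ 2 |k|_T² R²`. [folklore] -/
theorem sq_signedPhase_le (k r : TorusSite 2 L) (R : ℕ) (hr : ∀ i, (r i).valMinAbs.natAbs ≤ R) :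
    (2 * π / (L : ℝ) * ∑ i, (((k i).valMinAbs : ℤ) : ℝ) * (((r i).valMinAbs : ℤ) : ℝ)) ^ 2
      ≤ 2 * torusNorm L k ^ 2 * (R : ℝ) ^ 2 := by
  have hCS := Finset.sum_mul_sq_le_sq_mul_sq Finset.univ
    (fun i : Fin 2 => (((k i).valMinAbs : ℤ) : ℝ)) (fun i => (((r i).valMinAbs : ℤ) : ℝ))
  have hr2 : ∑ i : Fin 2, (((r i).valMinAbs : ℤ) : ℝ) ^ 2 ≤ 2 * (R : ℝ) ^ 2 := by
    have hi : ∀ i : Fin 2, (((r i).valMinAbs : ℤ) : ℝ) ^ 2 ≤ (R : ℝ) ^ 2 := by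
      intro i
      rw [← natAbs_valMinAbs_sq_eq]
      exact pow_le_pow_left₀ (Nat.cast_nonneg _) (by exact_mod_cast hr i) 2
    calc ∑ i : Fin 2, (((r i).valMinAbs : ℤ) : ℝ) ^ 2 ≤ ∑ _i : Fin 2, (R : ℝ) ^ 2 :=
          Finset.sum_le_sum fun i _ => hi i
      _ = 2 * (R : ℝ) ^ 2 := by rw [Finset.sum_const, Finset.card_univ, Fintype.card_fin]; ring
  have hnorm : torusNorm L k ^ 2 = (2 * π / (L : ℝ)) ^ 2 * ∑ i, (((k i).valMinAbs : ℤ) : ℝ) ^ 2 := by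
    rw [torusNorm_eq, mul_pow, Real.sq_sqrt (Finset.sum_nonneg fun i _ => sq_nonneg _)]
    simp_rw [natAbs_valMinAbs_sq_eq]
  rw [mul_pow, hnorm]
  have h0 : 0 ≤ (2 * π / (L : ℝ)) ^ 2 := sq_nonneg _
  have hk0 : 0 ≤ ∑ i, (((k i).valMinAbs : ℤ) : ℝ) ^ 2 := Finset.sum_nonneg fun i _ => sq_nonneg _
  calc (2 * π / (L : ℝ)) ^ 2 * (∑ i, (((k i).valMinAbs : ℤ) : ℝ) * (((r i).valMinAbs : ℤ) : ℝ)) ^ 2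
      ≤ (2 * π / (L : ℝ)) ^ 2 * ((∑ i, (((k i).valMinAbs : ℤ) : ℝ) ^ 2)
          * ∑ i, (((r i).valMinAbs : ℤ) : ℝ) ^ 2) := mul_le_mul_of_nonneg_left hCS h0
    _ ≤ (2 * π / (L : ℝ)) ^ 2 * ((∑ i, (((k i).valMinAbs : ℤ) : ℝ) ^ 2) * (2 * (R : ℝ) ^ 2)) :=
        mul_le_mul_of_nonneg_left (mul_le_mul_of_nonneg_left hr2 hk0) h0
    _ = 2 * ((2 * π / (L : ℝ)) ^ 2 * ∑ i, (((k i).valMinAbs : ℤ) : ℝ) ^ 2) * (R : ℝ) ^ 2 := by ring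

/-- The box `|r|_∞ ≤ R` of the torus has at most `(2R+1)²` points. [folklore] -/
theorem card_filter_box_le (R : ℕ) :
    ((Finset.univ.filter fun r : TorusSite 2 L => ∀ i, (r i).valMinAbs.natAbs ≤ R).card : ℝ)
      ≤ (2 * (R : ℝ) + 1) ^ 2 := by
  classical
  set A : Finset (ZMod L) := Finset.univ.filter fun a : ZMod L => a.valMinAbs.natAbs ≤ R with hA
  have hAcard : A.card ≤ 2 * R + 1 := by
    have hinj : Set.InjOn (ZMod.valMinAbs : ZMod L → ℤ) A := fun x _ y _ h => ZMod.injective_valMinAbs h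
    have hmaps : ∀ a ∈ A, (a.valMinAbs : ℤ) ∈ Finset.Icc (-(R : ℤ)) R := by
      intro a ha
      rw [hA, Finset.mem_filter] at ha
      have := ha.2
      rw [Finset.mem_Icc]; omega
    calc A.card ≤ (Finset.Icc (-(R : ℤ)) R).card := Finset.card_le_card_of_injOn _ hmaps hinj
      _ = 2 * R + 1 := by rw [Int.card_Icc]; omega
  have hsub : (Finset.univ.filter fun r : TorusSite 2 L => ∀ i, (r i).valMinAbs.natAbs ≤ R)
      ⊆ Fintype.piFinset fun _ : Fin 2 => A := by
    intro r hr
    rw [Finset.mem_filter] at hr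
    rw [Fintype.mem_piFinset]
    intro i
    rw [hA, Finset.mem_filter]
    exact ⟨Finset.mem_univ _, hr.2 i⟩
  have h1 := Finset.card_le_card hsub
  rw [Fintype.card_piFinset, Finset.prod_const, Finset.card_univ, Fintype.card_fin] at h1
  have h2 : ((Finset.univ.filter fun r : TorusSite 2 L => ∀ i, (r i).valMinAbs.natAbs ≤ R).card : ℝ)
      ≤ ((A.card ^ 2 : ℕ) : ℝ) := by exact_mod_cast h1
  refine h2.trans ?_
  have h3 : (A.card : ℝ) ≤ 2 * (R : ℝ) + 1 := by exact_mod_cast hAcard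
  push_cast
  nlinarith [h3, Nat.cast_nonneg (α := ℝ) A.card]

/-- **`ℓ¹ ≤ √(support) · ℓ²`:** a kernel supported in `|r|_∞ ≤ R` has `Σ_r |c(r)| ≤ (2R+1)(Σ_r c(r)²)^{1/2}`. [folklore] -/
theorem sum_abs_le_of_support (c : TorusSite 2 L → ℝ) (R : ℕ)
    (hsupp : ∀ r, c r ≠ 0 → ∀ i, (r i).valMinAbs.natAbs ≤ R) :
    ∑ r, |c r| ≤ (2 * (R : ℝ) + 1) * Real.sqrt (∑ r, c r ^ 2) := by
  classical
  set T := Finset.univ.filter fun r : TorusSite 2 L => ∀ i, (r i).valMinAbs.natAbs ≤ R with hT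
  -- restrict to the box
  have hres : ∑ r, |c r| = ∑ r ∈ T, |c r| := by
    rw [← Finset.sum_filter_of_ne (p := fun r : TorusSite 2 L => ∀ i, (r i).valMinAbs.natAbs ≤ R)]
    intro r _ hne
    exact hsupp r (fun h0 => hne (by rw [h0, abs_zero]))
  -- Cauchy–Schwarz on the box
  have hCS := Finset.sum_mul_sq_le_sq_mul_sq T (fun r => |c r|) (fun _ => (1 : ℝ))
  simp only [mul_one, one_pow, Finset.sum_const, nsmul_eq_mul] at hCS
  have hT2 : ∑ r ∈ T, |c r| ^ 2 ≤ ∑ r, c r ^ 2 := by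
    calc ∑ r ∈ T, |c r| ^ 2 = ∑ r ∈ T, c r ^ 2 := Finset.sum_congr rfl fun r _ => sq_abs _
      _ ≤ ∑ r, c r ^ 2 := Finset.sum_le_sum_of_subset_of_nonneg (Finset.filter_subset _ _)
          fun r _ _ => sq_nonneg _
  have hcard := card_filter_box_le (L := L) R
  rw [← hT] at hcard
  have hS0 : 0 ≤ ∑ r ∈ T, |c r| := Finset.sum_nonneg fun r _ => abs_nonneg _
  rw [hres]
  -- `(Σ|c|)² ≤ |T| Σ c² ≤ (2R+1)² Σ c²`
  have hsq : (∑ r ∈ T, |c r|) ^ 2 ≤ ((2 * (R : ℝ) + 1) * Real.sqrt (∑ r, c r ^ 2)) ^ 2 := by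
    rw [mul_pow, Real.sq_sqrt (Finset.sum_nonneg fun r _ => sq_nonneg _)]
    calc (∑ r ∈ T, |c r|) ^ 2 ≤ (∑ r ∈ T, |c r| ^ 2) * (T.card : ℝ) := hCS
      _ ≤ (∑ r, c r ^ 2) * (2 * (R : ℝ) + 1) ^ 2 :=
          mul_le_mul hT2 hcard (Nat.cast_nonneg _) (Finset.sum_nonneg fun r _ => sq_nonneg _)
      _ = (2 * (R : ℝ) + 1) ^ 2 * ∑ r, c r ^ 2 := by ring
  have hR : 0 ≤ (2 * (R : ℝ) + 1) * Real.sqrt (∑ r, c r ^ 2) := by positivity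
  exact (pow_le_pow_iff_left₀ hS0 hR two_ne_zero).mp hsq

/-- **Parseval + sup:** `|P(k′)| ≤ B` at every grid momentum gives `Σ_r c(r)² ≤ B²`. [folklore] -/
theorem sum_sq_le_of_kernelFT_le (c : TorusSite 2 L → ℝ) (B : ℝ) (hB : ∀ k, ‖kernelFT L c k‖ ≤ B) :
    ∑ r, c r ^ 2 ≤ B ^ 2 := by
  have hL : (0 : ℝ) < (L : ℝ) ^ 2 := by
    have : (0 : ℝ) < (L : ℝ) := by exact_mod_cast Nat.pos_of_ne_zero (NeZero.ne L)
    positivity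
  have hpar := sum_kernelFT_mul_conj c c
  -- real parts: `Σ_k ‖P k‖² = L² Σ c²`
  have h1 : (∑ k, kernelFT L c k * conj (kernelFT L c k)) = ((∑ k, ‖kernelFT L c k‖ ^ 2 : ℝ) : ℂ) := by
    push_cast
    refine Finset.sum_congr rfl fun k _ => ?_
    rw [Complex.mul_conj, Complex.normSq_eq_norm_sq]; push_cast; rfl
  have h2 : ((L : ℂ) ^ 2) * ∑ s, ((c s * c s : ℝ) : ℂ) = (((L : ℝ) ^ 2 * ∑ s, c s ^ 2 : ℝ) : ℂ) := by
    push_cast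
    congr 1
    exact Finset.sum_congr rfl fun s _ => by ring
  rw [h1, h2] at hpar
  have hreal : ∑ k, ‖kernelFT L c k‖ ^ 2 = (L : ℝ) ^ 2 * ∑ s, c s ^ 2 := by exact_mod_cast hpar
  have hbound : ∑ k, ‖kernelFT L c k‖ ^ 2 ≤ (L : ℝ) ^ 2 * B ^ 2 := by
    calc ∑ k, ‖kernelFT L c k‖ ^ 2 ≤ ∑ _k : TorusSite 2 L, B ^ 2 :=
          Finset.sum_le_sum fun k _ => pow_le_pow_left₀ (norm_nonneg _) (hB k) 2
      _ = (L : ℝ) ^ 2 * B ^ 2 := by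
          rw [Finset.sum_const, Finset.card_univ, nsmul_eq_mul, Fintype.card_fun, ZMod.card,
            Fintype.card_fin]
          push_cast; ring
  rw [hreal] at hbound
  exact le_of_mul_le_mul_left hbound hL

/-! ## The near-field bound -/

/-- **STUB (S4) — THE NEAR-FIELD LEMMA** (theory seat memo ROTOR-THEORY-8 §107 L4 / §109 (S4)).  For an EVEN
real kernel `c` on `(ℤ/L)²` supported in the box `|r|_∞ ≤ R` whose transform `P = kernelFT L c` is bounded by
`B` at every grid momentum: `|P(k) − P(0)| ≤ |k|_T² R² (2R+1) B` for every grid momentum `k`. [folklore] -/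
theorem norm_kernelFT_sub_kernelFT_zero_le (c : TorusSite 2 L → ℝ) (R : ℕ) (B : ℝ)
    (hsupp : ∀ r, c r ≠ 0 → ∀ i, (r i).valMinAbs.natAbs ≤ R) (heven : ∀ r, c (-r) = c r)
    (hB : ∀ k, ‖kernelFT L c k‖ ≤ B) (k : TorusSite 2 L) :
    ‖kernelFT L c k - kernelFT L c 0‖ ≤ torusNorm L k ^ 2 * (R : ℝ) ^ 2 * (2 * (R : ℝ) + 1) * B := by
  have hB0 : 0 ≤ B := (norm_nonneg _).trans (hB 0)
  rw [kernelFT_eq_sum_mul_cos c heven k, kernelFT_eq_sum_mul_cos c heven 0, ← Complex.ofReal_sub,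
    Complex.norm_real, Real.norm_eq_abs, ← Finset.sum_sub_distrib]
  -- termwise: `|c r (cos θ − cos 0)| ≤ |c r| · |k|² R²`
  have hterm : ∀ r, |c r * Real.cos (2 * π / (L : ℝ) *
        ∑ i, (((k i).valMinAbs : ℤ) : ℝ) * (((r i).valMinAbs : ℤ) : ℝ))
      - c r * Real.cos (2 * π / (L : ℝ) *
        ∑ i, ((((0 : TorusSite 2 L) i).valMinAbs : ℤ) : ℝ) * (((r i).valMinAbs : ℤ) : ℝ))|
      ≤ |c r| * (torusNorm L k ^ 2 * (R : ℝ) ^ 2) := by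
    intro r
    have h0 : Real.cos (2 * π / (L : ℝ) *
        ∑ i, ((((0 : TorusSite 2 L) i).valMinAbs : ℤ) : ℝ) * (((r i).valMinAbs : ℤ) : ℝ)) = 1 := by
      simp [ZMod.valMinAbs_zero]
    rw [h0, ← mul_sub, abs_mul]
    by_cases hc : c r = 0
    · rw [hc, abs_zero, zero_mul, zero_mul]
    · refine mul_le_mul_of_nonneg_left ?_ (abs_nonneg _)
      -- `|cos θ − 1| ≤ θ²/2 ≤ |k|² R²` (the tree's `SixVertex.abs_cos_sub_one_le`, inlined)
      have hcos : ∀ x : ℝ, |Real.cos x - 1| ≤ x ^ 2 / 2 := fun x => by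
        rw [abs_sub_comm, abs_of_nonneg (by linarith [Real.cos_le_one x])]
        linarith [Real.one_sub_sq_div_two_le_cos (x := x)]
      refine (hcos _).trans ?_
      have := sq_signedPhase_le k r R (hsupp r hc)
      linarith
  calc |∑ r, (c r * Real.cos (2 * π / (L : ℝ) *
          ∑ i, (((k i).valMinAbs : ℤ) : ℝ) * (((r i).valMinAbs : ℤ) : ℝ))
        - c r * Real.cos (2 * π / (L : ℝ) *
          ∑ i, ((((0 : TorusSite 2 L) i).valMinAbs : ℤ) : ℝ) * (((r i).valMinAbs : ℤ) : ℝ)))|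
      ≤ ∑ r, |c r * Real.cos (2 * π / (L : ℝ) *
          ∑ i, (((k i).valMinAbs : ℤ) : ℝ) * (((r i).valMinAbs : ℤ) : ℝ))
        - c r * Real.cos (2 * π / (L : ℝ) *
          ∑ i, ((((0 : TorusSite 2 L) i).valMinAbs : ℤ) : ℝ) * (((r i).valMinAbs : ℤ) : ℝ))| :=
        Finset.abs_sum_le_sum_abs _ _
    _ ≤ ∑ r, |c r| * (torusNorm L k ^ 2 * (R : ℝ) ^ 2) := Finset.sum_le_sum fun r _ => hterm r
    _ = (∑ r, |c r|) * (torusNorm L k ^ 2 * (R : ℝ) ^ 2) := by rw [Finset.sum_mul]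
    _ ≤ ((2 * (R : ℝ) + 1) * Real.sqrt (∑ r, c r ^ 2)) * (torusNorm L k ^ 2 * (R : ℝ) ^ 2) :=
        mul_le_mul_of_nonneg_right (sum_abs_le_of_support c R hsupp) (by positivity)
    _ ≤ ((2 * (R : ℝ) + 1) * B) * (torusNorm L k ^ 2 * (R : ℝ) ^ 2) := by
        refine mul_le_mul_of_nonneg_right (mul_le_mul_of_nonneg_left ?_ (by positivity)) (by positivity)
        calc Real.sqrt (∑ r, c r ^ 2) ≤ Real.sqrt (B ^ 2) := Real.sqrt_le_sqrt (sum_sq_le_of_kernelFT_le c B hB)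
          _ = B := Real.sqrt_sq hB0
    _ = torusNorm L k ^ 2 * (R : ℝ) ^ 2 * (2 * (R : ℝ) + 1) * B := by ring

end Summit.HubbardSuperconductivity.HubbardSuperconductivity.Theorems.AnisotropyChord.Stiffness
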